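import Summits.ResolutionOfSingularities.ResolutionOfSingularities.Theorems.WildQuotientsSummitReductionStubPairOrbitNormalFormBlowupChartsOverCentreReduction
import HarnessLib

/-!
# `WildQuotients.SummitReduction` (stmt-ResolutionOfSingularities-16324), line `FramePerfect`, stub O3
# (`stub_pair_orbitNormalFormBlowup_chartsOverCentre`): fields 4.25 (i)/(ii) upstairs at the closed
# points over the orbit centre, FROM the chart computation on the coefficient-free model (2/2)

Route `ResolutionOfSingularities/WildQuotients`, crux `SummitReduction`; helper file of the line
skeleton (v9–v10), stub O3 = de Jong 1996, 4.27 [C2] for `DeJong1997.QuasiSplitNormalFormPair`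
(de Jong 1997, 5.11 ¶3: "The resulting scheme has a local description as above by the computations
of [1, 4.27]"). The printed proof (de Jong 1996, p. 76) computes the charts of the blow-up of
"the scheme `Spec k⟦u, v, t₁, …, t_{d-1}⟧/(uv - t₁ ⋯ t_s)` in the ideal `(u, v, t₁, t₂)`", i.e. of
the blow-up BASE-CHANGED to a formal model of `𝒪_{X,x}` at the point `x = π(x')` of the centre.
This file REDUCES the stub to that single model-level statement (hypothesis `hNB2`, the sub-goal
"NB2"; compare the S worker's `stub_pair_orbitNormalFormBlowup_singularOverCentre_of_model` for
[C1]): for a regular local ring `A` with regular system of parameters `t`, `2 ≤ s ≤ r ≤ m`,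
`a₀ < b₀ < s`, the model `M = A⟦u, v⟧/(uv - ∏_{i<s} tᵢ)`, ANY blow-up `ρ₁ : B → Spec M` in
`𝔭 = (t_{a₀}, t_{b₀}) M + (u, v)` and any closed point `y` of `B` over the closed point: the
exceptional ideal `𝔭 𝒪_{B,y}` is generated by a non-zero-divisor `G`, the boundary
`(∏_{i<r} tᵢ) 𝒪_{B,y}` is `(G² w)` with `√((G² w) 𝒪̂_{B,y}) = (G w) 𝒪̂_{B,y}` (the boundary passes
doubly through the exceptional divisor), `(G w)` has local strict normal crossings data if
`𝒪_{B,y}` is regular, and `(𝒪̂_{B,y}, (G w)) ≅ (A'⟦u, v⟧/(uv - ∏_{i<s'} t'ᵢ), (∏_{i<r'} t'ᵢ))` for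
a new regular local `A'` of dimension `m`, `2 ≤ s' ≤ r' ≤ m`, if not.

* `chartsOverCentre_isSNCIdeal_map_adicCompletion` — local strict normal crossings data pass to
  the completion;
* `chartsOverCentre_point_of_model` — (O3) at ONE closed point `x'` over the centre, from `hNB2`
  and the transfer package of the sibling file `…ChartsOverCentreReduction`
  (`chartsOverCentre_point_transfer`): `hNB2` at the closed point `y` of `B` over `x'`; and back
  in `𝒪̂_{X',x'} ≅ 𝒪̂_{B,y}`: the completed ideal of `π⁻¹ Z` is `√(I_Z 𝒪_{X',x'}) 𝒪̂ = √(I_Z 𝒪̂)` by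
  `radical_map_eq_of_sq_mul` (a local equation `b` of the exceptional divisor at `x'` generates
  `𝔭 𝒪_{B,y}`, so `b = unit · G`), which is the transported `(G w) 𝒪̂_{B,y}`;
* `stub_pair_orbitNormalFormBlowup_chartsOverCentre_of_model` — the stub with its binders, from
  `hNB2`.

## Sources

* A. J. de Jong, *Smoothness, semi-stability and alterations*, Publ. Math. IHÉS 83 (1996), 4.25–4.27,
  pp. 75–76. [DeJong1996]
* A. J. de Jong, *Families of curves and alterations*, Ann. Inst. Fourier 47 (1997), proof of
  Prop. 5.11, p. 619. [DeJong1997]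
* H. Matsumura, *Commutative Ring Theory* (1986), Thm. 7.5, 8.11, 23.7. [Matsumura1987]
-/

set_option linter.dupNamespace false -- the tree's summit namespace repeats `ResolutionOfSingularities`

noncomputable section

open CategoryTheory CategoryTheory.Limits AlgebraicGeometry TopologicalSpace Topology
open Literature.AlgebraicGeometry.Resolution
open Literature.AlgebraicGeometry
open IsLocalRing Scheme.IdealSheafData

namespace Summit.ResolutionOfSingularities.ResolutionOfSingularities.Theorems

/-! ## Completion -/

/-- **Local strict normal crossings data pass to the completion**: if `I = (x₁ ⋯ x_r)` for part
`x` of a regular system of parameters of the regular local ring `O`, then `I Ô = (x₁ ⋯ x_r) Ô` with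
`x` part of a regular system of parameters of the regular local ring `Ô` (`𝔪 Ô = 𝔪̂`,
`dim Ô = dim O`). [cite: Matsumura1987, Thm. 8.11 and proof of Thm. 19.5] -/
theorem chartsOverCentre_isSNCIdeal_map_adicCompletion {O : Type} [CommRing O] [IsLocalRing O]
    [IsNoetherianRing O] {I : Ideal O} (h : IsSNCIdeal I) :
    IsSNCIdeal (I.map (algebraMap O (AdicCompletion (maximalIdeal O) O))) := by
  obtain ⟨hreg, r, e, x, y, hr, hdim, hspan, rfl⟩ := h
  haveI := hreg
  refine ⟨isRegularLocalRing_adicCompletion O, r, e, algebraMap O _ ∘ x, algebraMap O _ ∘ y, hr,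
    ?_, ?_, ?_⟩
  · rw [ringKrullDim_adicCompletion, hdim]
  · rw [AdicCompletion.maximalIdeal_eq_map, ← hspan, Ideal.map_span, Set.image_union,
      ← Set.range_comp, ← Set.range_comp]
  · rw [Ideal.map_span, Set.image_singleton, map_prod]
    rfl

/-! ## (O3) at one closed point over the centre -/

/-- **Fields 4.25 (i)/(ii) upstairs at ONE closed point `x'` over the orbit centre, from the
model chart statement `hNB2`** (de Jong 1996, 4.27 [C2], coefficient-free and for orbit centres):
`chartsOverCentre_point_transfer` moves the question to the closed point `y` of the base-changed
blow-up `ρ₁ : B → Spec M`, where `hNB2` gives `𝔭 𝒪_{B,y} = (G)`, `(∏_{i<r} tᵢ) 𝒪_{B,y} = (G² w)`,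
`√((G² w) 𝒪̂_{B,y}) = (G w) 𝒪̂_{B,y}` and the description of `(G w)`; a local equation `b` of the
exceptional divisor at `x'` maps to a unit multiple of `G`, so `I_Z 𝒪̂_{X',x'} = (b² w₁)` with
`√(I_Z 𝒪̂_{X',x'}) = (b w₁)` through `Ξ : 𝒪̂_{X',x'} ≅ 𝒪̂_{B,y}`, whence the completed ideal of
`π⁻¹ Z` at `x'`, `√(I_Z 𝒪_{X',x'}) 𝒪̂ = √(I_Z 𝒪̂)` (`radical_map_eq_of_sq_mul`), is the transported
`(G w) 𝒪̂_{B,y}`: with local strict normal crossings data at a regular `x'` (i), and of the form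
`(∏_{i<r'} t'ᵢ)` in `A'⟦u, v⟧/(uv - ∏_{i<s'} t'ᵢ) ≅ 𝒪̂_{B,y} ≅ 𝒪̂_{X',x'}` at a singular one (ii).
[cite: DeJong1996, 4.27, pp. 75–76] [cite: DeJong1997, proof of Prop. 5.11, p. 619] -/
theorem chartsOverCentre_point_of_model {k : Type} [Field k] {X X' : Scheme.{0}}
    {p : X ⟶ Spec (.of k)} {Z : Set X} {G : Type} [Group G] [Finite G] {ρ : G →* Aut X} {d : ℕ}
    (hP : DeJong1997.QuasiSplitNormalFormPair p Z ρ d)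
    {E : Set ↥({x : X | ¬ IsRegularLocalRing (X.presheaf.stalk x)} : Set X)}
    (hE : E ∈ irreducibleComponents ↥({x : X | ¬ IsRegularLocalRing (X.presheaf.stalk x)} : Set X))
    {π : X' ⟶ X}
    (hπ : IsBlowup π (vanishingIdeal
      ⟨closure (⋃ g : G, (ρ g).hom.base '' (Subtype.val '' E)), isClosed_closure⟩))
    [LocallyOfFiniteType π]
    (hNB2 : ∀ (A : Type) [CommRing A] [IsRegularLocalRing A] (m : ℕ) (t : Fin m → A),
      Ideal.span (Set.range t) = IsLocalRing.maximalIdeal A → ringKrullDim A = m →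
      ∀ (s r : ℕ), 2 ≤ s → s ≤ r → r ≤ m → ∀ (a₀ b₀ : Fin m), a₀ < b₀ → b₀.val < s →
      ∀ (B : Scheme.{0}) (ρ₁ : B ⟶ Spec (.of (DeJong1996.NodeDeformationRing A
          (∏ i ∈ Finset.univ.filter (fun i : Fin m => i.val < s), t i)))),
        IsBlowup ρ₁ (Scheme.IdealSheafData.ofIdealTop
          ((((Ideal.span {t a₀, t b₀}).map (DeJong1996.NodeDeformationRing.ofBase A _) ⊔
              Ideal.span {Ideal.Quotient.mk _ (MvPowerSeries.X 0),
                Ideal.Quotient.mk _ (MvPowerSeries.X 1)})).map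
            (Scheme.ΓSpecIso (.of (DeJong1996.NodeDeformationRing A
              (∏ i ∈ Finset.univ.filter (fun i : Fin m => i.val < s), t i)))).inv.hom)) →
        ∀ y : B, IsClosed ({y} : Set B) → (∀ f, f ∈ (ρ₁.base y).asIdeal ∨ IsUnit f) →
          ∃ G w : B.presheaf.stalk y,
            stalkIdeal ((Scheme.IdealSheafData.ofIdealTop
              ((((Ideal.span {t a₀, t b₀}).map (DeJong1996.NodeDeformationRing.ofBase A _) ⊔
                Ideal.span {Ideal.Quotient.mk _ (MvPowerSeries.X 0),
                  Ideal.Quotient.mk _ (MvPowerSeries.X 1)})).map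
              (Scheme.ΓSpecIso (.of (DeJong1996.NodeDeformationRing A
                (∏ i ∈ Finset.univ.filter (fun i : Fin m => i.val < s), t i)))).inv.hom)).comap ρ₁) y =
              Ideal.span {G} ∧
            G ∈ nonZeroDivisors (B.presheaf.stalk y) ∧
            stalkIdeal ((Scheme.IdealSheafData.ofIdealTop
              ((Ideal.span {DeJong1996.NodeDeformationRing.ofBase A _
                (∏ i ∈ Finset.univ.filter (fun i : Fin m => i.val < r), t i)}).map
              (Scheme.ΓSpecIso (.of (DeJong1996.NodeDeformationRing A
                (∏ i ∈ Finset.univ.filter (fun i : Fin m => i.val < s), t i)))).inv.hom)).comap ρ₁) y =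
              Ideal.span {G ^ 2 * w} ∧
            ((stalkIdeal ((Scheme.IdealSheafData.ofIdealTop
              ((Ideal.span {DeJong1996.NodeDeformationRing.ofBase A _
                (∏ i ∈ Finset.univ.filter (fun i : Fin m => i.val < r), t i)}).map
              (Scheme.ΓSpecIso (.of (DeJong1996.NodeDeformationRing A
                (∏ i ∈ Finset.univ.filter (fun i : Fin m => i.val < s), t i)))).inv.hom)).comap ρ₁) y).map
                (algebraMap (B.presheaf.stalk y) (AdicCompletion
                  (IsLocalRing.maximalIdeal (B.presheaf.stalk y)) (B.presheaf.stalk y)))).radical =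
              (Ideal.span {G * w}).map (algebraMap (B.presheaf.stalk y) (AdicCompletion
                  (IsLocalRing.maximalIdeal (B.presheaf.stalk y)) (B.presheaf.stalk y))) ∧
            (IsRegularLocalRing (B.presheaf.stalk y) → IsSNCIdeal (Ideal.span {G * w})) ∧
            (¬ IsRegularLocalRing (B.presheaf.stalk y) →
              ∃ (A' : Type) (_ : CommRing A') (_ : IsRegularLocalRing A') (t' : Fin m → A') (s' r' : ℕ),
                Ideal.span (Set.range t') = IsLocalRing.maximalIdeal A' ∧ ringKrullDim A' = m ∧
                2 ≤ s' ∧ s' ≤ r' ∧ r' ≤ m ∧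
                ∃ e : AdicCompletion (IsLocalRing.maximalIdeal (B.presheaf.stalk y))
                    (B.presheaf.stalk y) ≃+*
                    DeJong1996.NodeDeformationRing A'
                      (∏ i ∈ Finset.univ.filter (fun i : Fin m => i.val < s'), t' i),
                  ((Ideal.span {G * w}).map (algebraMap (B.presheaf.stalk y) _)).map e.toRingHom =
                    Ideal.span {DeJong1996.NodeDeformationRing.ofBase A' _
                      (∏ i ∈ Finset.univ.filter (fun i : Fin m => i.val < r'), t' i)}))
    {x' : X'} (hx'c : IsClosed ({x'} : Set X'))
    (hx : π.base x' ∈ closure (⋃ g : G, (ρ g).hom.base '' (Subtype.val '' E))) :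
    (∀ [IsRegularLocalRing (X'.presheaf.stalk x')],
      ∀ (U : X'.affineOpens) (hU : x' ∈ (U : X'.Opens)),
        IsSNCIdeal (completedStalkIdeal (vanishingIdeal
          ⟨π.base ⁻¹' Z, hP.isClosed.preimage π.continuous⟩) x' U hU)) ∧
    (¬ IsRegularLocalRing (X'.presheaf.stalk x') →
      ∃ (A : Type) (_ : CommRing A) (_ : IsRegularLocalRing A) (t : Fin (d - 1) → A) (s r : ℕ),
        Ideal.span (Set.range t) = IsLocalRing.maximalIdeal A ∧ ringKrullDim A = (d - 1 : ℕ) ∧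
        2 ≤ s ∧ s ≤ r ∧ r ≤ d - 1 ∧
        ∃ e : AdicCompletion (IsLocalRing.maximalIdeal (X'.presheaf.stalk x'))
            (X'.presheaf.stalk x') ≃+*
            DeJong1996.NodeDeformationRing A
              (∏ i ∈ Finset.univ.filter (fun i : Fin (d - 1) => i.val < s), t i),
          ∀ (U : X'.affineOpens) (hU : x' ∈ (U : X'.Opens)),
            (completedStalkIdeal (vanishingIdeal
                ⟨π.base ⁻¹' Z, hP.isClosed.preimage π.continuous⟩) x' U hU).map e.toRingHom =
              Ideal.span {DeJong1996.NodeDeformationRing.ofBase A _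
                (∏ i ∈ Finset.univ.filter (fun i : Fin (d - 1) => i.val < r), t i)}) := by
  haveI := hP.isIntegral
  haveI := hP.locallyOfFiniteType
  haveI : IsNoetherian X := hP.isNoetherian
  haveI : IsLocallyNoetherian X' := LocallyOfFiniteType.isLocallyNoetherian (π ≫ p)
  haveI : IsIntegral X' := hπ.isIntegral (hP.vanishingIdeal_orbit_ne_bot E)
  obtain ⟨A, _, _, t, s, r, hspan, hdim, hs2, hsr, hrd, a₀, b₀, hab₀, hb₀s, B, ρ₁, y, φ, Ξ, hB, hyc,
    hρy', hregiff, hΞ, hIZ', hIC'⟩ := chartsOverCentre_point_transfer hP hE hπ hx'c hx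
  obtain ⟨Gy, wy, h𝔠, hGy, h𝔞, hrad, hregc, hsingc⟩ :=
    hNB2 A (d - 1) t hspan hdim s r hs2 hsr hrd a₀ b₀ hab₀ hb₀s B ρ₁ hB y hyc hρy'
  -- the `X'`-side: `𝒪_{X',x'}`, its completion, and the stalk ideals of `π⁻¹ Z`, `π⁻¹ C`
  set IZ : X.IdealSheafData := vanishingIdeal ⟨Z, hP.isClosed⟩ with hIZ
  set IC : X.IdealSheafData := vanishingIdeal ⟨closure (⋃ g : G, (ρ g).hom.base '' (Subtype.val '' E)),
      isClosed_closure⟩ with hIC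
  have h𝔞Zφ : (stalkIdeal (IZ.comap π) x').map φ = Ideal.span {Gy ^ 2 * wy} := by
    rw [hIZ, hIZ']
    exact h𝔞
  have h𝔞Zrad : (((stalkIdeal (IZ.comap π) x').map φ).map (algebraMap (B.presheaf.stalk y)
      (AdicCompletion (maximalIdeal (B.presheaf.stalk y)) (B.presheaf.stalk y)))).radical =
      (Ideal.span {Gy * wy}).map (algebraMap (B.presheaf.stalk y)
        (AdicCompletion (maximalIdeal (B.presheaf.stalk y)) (B.presheaf.stalk y))) := by
    rw [hIZ, hIZ']
    exact hrad
  have h𝔞Cφ : (stalkIdeal (IC.comap π) x').map φ = Ideal.span {Gy} := by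
    rw [hIC, hIC']
    exact h𝔠
  -- a local equation `b` of the exceptional divisor at `x'`
  obtain ⟨V, hxV, f, hf, hfV⟩ := hπ.isEffectiveCartier x'
  haveI : Nonempty (V : X'.Opens) := ⟨⟨x', hxV⟩⟩
  set b : (X'.presheaf.stalk x' : Type) := (X'.presheaf.germ V x' hxV).hom f with hbdef
  have h𝔞Cb : stalkIdeal (IC.comap π) x' = Ideal.span {b} := by
    rw [stalkIdeal_eq_map_germ _ V hxV, hfV, Ideal.map_span, Set.image_singleton]
  have hb : b ∈ nonZeroDivisors (X'.presheaf.stalk x') :=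
    mem_nonZeroDivisors_of_ne_zero
      ((map_ne_zero_iff _ (germ_injective_of_isIntegral X' x' hxV)).mpr (nonZeroDivisors.ne_zero hf))
  -- `φ b` and `Gy` generate the same ideal of `𝒪_{B,y}`
  have hspan' : Ideal.span {Gy} = Ideal.span {φ b} := by
    rw [← h𝔞Cφ, h𝔞Cb, Ideal.map_span, Set.image_singleton]
  obtain ⟨a, ha⟩ : ∃ a, a * φ b = Gy :=
    Ideal.mem_span_singleton'.mp (hspan'.le (Ideal.mem_span_singleton_self Gy))
  have hau : IsUnit a :=
    isUnit_of_span_singleton_eq_span_singleton_of_eq_mul hGy hspan' ha.symm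
  -- the completion of `𝒪_{X',x'}` and the trick `√(I_Z 𝒪) 𝒪̂ = √(I_Z 𝒪̂)`
  haveI : Module.FaithfullyFlat (X'.presheaf.stalk x')
      (AdicCompletion (maximalIdeal (X'.presheaf.stalk x')) (X'.presheaf.stalk x')) :=
    Module.FaithfullyFlat.of_flat_of_isLocalHom
  have hβ : algebraMap (X'.presheaf.stalk x')
      (AdicCompletion (maximalIdeal (X'.presheaf.stalk x')) (X'.presheaf.stalk x')) b ∈
        nonZeroDivisors _ :=
    map_mem_nonZeroDivisors_of_flat _ (RingHom.flat_algebraMap_iff.mpr inferInstance) hb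
  have hΞ' : (Ξ : _ →+* _).comp (algebraMap (X'.presheaf.stalk x')
      (AdicCompletion (maximalIdeal (X'.presheaf.stalk x')) (X'.presheaf.stalk x'))) =
      (algebraMap (B.presheaf.stalk y)
        (AdicCompletion (maximalIdeal (B.presheaf.stalk y)) (B.presheaf.stalk y))).comp φ :=
    RingHom.ext fun z => hΞ z
  have hΞmap : ∀ 𝔞 : Ideal (X'.presheaf.stalk x'), 𝔞.map (algebraMap (X'.presheaf.stalk x')
      (AdicCompletion (maximalIdeal (X'.presheaf.stalk x')) (X'.presheaf.stalk x'))) =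
      ((𝔞.map φ).map (algebraMap (B.presheaf.stalk y)
        (AdicCompletion (maximalIdeal (B.presheaf.stalk y)) (B.presheaf.stalk y)))).map
        (Ξ.symm : _ →+* _) := by
    intro 𝔞
    rw [← Ideal.map_of_equiv (I := 𝔞.map (algebraMap (X'.presheaf.stalk x') _)) Ξ,
      Ideal.map_map (algebraMap (X'.presheaf.stalk x') _), hΞ', ← Ideal.map_map]
  have hΞb : Ξ.symm (algebraMap (B.presheaf.stalk y) _ (φ b)) =
      algebraMap (X'.presheaf.stalk x') _ b := by
    rw [RingEquiv.symm_apply_eq, hΞ]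
  set w₁ : AdicCompletion (maximalIdeal (X'.presheaf.stalk x')) (X'.presheaf.stalk x') :=
    Ξ.symm (algebraMap (B.presheaf.stalk y) _ (a * wy)) with hw₁
  have h1 : (stalkIdeal (IZ.comap π) x').map (algebraMap (X'.presheaf.stalk x') _) =
      Ideal.span {algebraMap (X'.presheaf.stalk x') _ b ^ 2 * w₁} := by
    rw [hΞmap, h𝔞Zφ, Ideal.map_span, Set.image_singleton, Ideal.map_span, Set.image_singleton,
      RingHom.coe_coe, ← ha]
    have : Ξ.symm (algebraMap (B.presheaf.stalk y)
        (AdicCompletion (maximalIdeal (B.presheaf.stalk y)) (B.presheaf.stalk y)) ((a * φ b) ^ 2 * wy)) =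
        Ξ.symm (algebraMap (B.presheaf.stalk y) _ a) *
          (algebraMap (X'.presheaf.stalk x') _ b ^ 2 * w₁) := by
      rw [hw₁, ← hΞb]
      simp only [← map_pow, ← map_mul]
      congr 2
      simp only [map_pow]
      ring
    rw [this]
    exact Ideal.span_singleton_mul_left_unit ((hau.map _).map _) _
  have h2 : ((stalkIdeal (IZ.comap π) x').map (algebraMap (X'.presheaf.stalk x') _)).radical =
      Ideal.span {algebraMap (X'.presheaf.stalk x') _ b * w₁} := by
    rw [hΞmap, ← Ideal.map_radical_of_surjective Ξ.symm.surjective (by simp), h𝔞Zrad,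
      Ideal.map_span, Set.image_singleton, Ideal.map_span, Set.image_singleton, RingHom.coe_coe,
      ← ha, hw₁, ← hΞb]
    simp only [← map_mul]
    congr 3
    ring
  have hkey := radical_map_eq_of_sq_mul (R := X'.presheaf.stalk x')
    (C := AdicCompletion (maximalIdeal (X'.presheaf.stalk x')) (X'.presheaf.stalk x'))
    (stalkIdeal (IZ.comap π) x') b w₁ hβ h1 h2
  -- the completed ideal of `π⁻¹ Z` at `x'`
  have hÎ : ∀ (U' : X'.affineOpens) (hU' : x' ∈ (U' : X'.Opens)),
      completedStalkIdeal (vanishingIdeal ⟨π.base ⁻¹' Z, hP.isClosed.preimage π.continuous⟩) x' U' hU' =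
        ((Ideal.span {Gy * wy}).map (algebraMap (B.presheaf.stalk y)
          (AdicCompletion (maximalIdeal (B.presheaf.stalk y)) (B.presheaf.stalk y)))).map
          (Ξ.symm : _ →+* _) := by
    intro U' hU'
    have h3 := stalkIdeal_vanishingIdeal_preimage π ⟨Z, hP.isClosed⟩ x'
    rw [← stalkIdeal_comap_eq_map_stalkMap] at h3
    rw [completedStalkIdeal_eq_map_stalkIdeal]
    change (stalkIdeal (vanishingIdeal ((⟨Z, hP.isClosed⟩ : Closeds X).preimage π.continuous)) x').map
      (algebraMap _ _) = _
    rw [h3, hkey, hΞmap, ← Ideal.map_radical_of_surjective Ξ.symm.surjective (by simp), h𝔞Zrad]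
  constructor
  · -- (i): a regular point
    intro hreg U' hU'
    have hreg' : IsRegularLocalRing (B.presheaf.stalk y) := hregiff.mp hreg
    haveI := hreg'
    rw [hÎ U' hU']
    exact IsSNCIdeal.of_ringEquiv Ξ.symm (chartsOverCentre_isSNCIdeal_map_adicCompletion (hregc hreg'))
  · -- (ii): a singular point
    intro hsing
    have hsing' : ¬ IsRegularLocalRing (B.presheaf.stalk y) := fun h => hsing (hregiff.mpr h)
    obtain ⟨A', _, _, t', s', r', hsp', hdim', hs', hsr', hrd', e', he'⟩ := hsingc hsing'
    refine ⟨A', _, ‹_›, t', s', r', hsp', hdim', hs', hsr', hrd', Ξ.trans e', fun U' hU' => ?_⟩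
    rw [hÎ U' hU', ← he', Ideal.map_map]
    congr 1
    ext z
    change e' (Ξ (Ξ.symm z)) = e' z
    rw [RingEquiv.apply_symm_apply]

/-! ## The stub from the model chart statement -/

/-- **Stub O3 from the chart computation on the coefficient-free model** — the hypotheses
`hO3i ∧ hO3ii` of `quasiSplitNormalFormPair_blowup_of_overCentre` with the binders of the stub
`stub_pair_orbitNormalFormBlowup_chartsOverCentre`, from the single model-level statement `hNB2`
(de Jong 1996, 4.27 [C2]: "Chart "`u ≠ 0`" … Clearly, this is smooth and `Z` is given by
`ut₁'t₂'t₃ ⋯ t_r = 0`, a normal crossings divisor. Chart "`t₁ ≠ 0`" … `u'v' - t₂'t₃ ⋯ t_s = 0`.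
The divisor `Z'` is given by `t₁t₂'t₃ ⋯ t_r = 0`. Clearly the singularities are of the type
described in (ii)"; de Jong 1997, 5.11 ¶3 for the orbit centres).
[cite: DeJong1996, 4.27, pp. 75–76] [cite: DeJong1997, proof of Prop. 5.11, p. 619] -/
theorem stub_pair_orbitNormalFormBlowup_chartsOverCentre_of_model (k : Type) [Field k]
    [PerfectField k] (G : Type) [Group G] [Finite G]
    (X : Scheme.{0}) (p : X ⟶ Spec (.of k)) (ρ : G →* Aut X) (Z : Set X) (d : ℕ)
    (hP : DeJong1997.QuasiSplitNormalFormPair p Z ρ d)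
    (E : Set ↥({x : X | ¬ IsRegularLocalRing (X.presheaf.stalk x)} : Set X))
    (hE : E ∈ irreducibleComponents ↥({x : X | ¬ IsRegularLocalRing (X.presheaf.stalk x)} : Set X))
    (X' : Scheme.{0}) (π : X' ⟶ X) (_ρ' : G →* Aut X')
    (hπ : IsBlowup π (Scheme.IdealSheafData.vanishingIdeal
      ⟨closure (⋃ g : G, (ρ g).hom.base '' (Subtype.val '' E)), isClosed_closure⟩))
    (_hπG : ∀ g : G, (_ρ' g).hom ≫ π = π ≫ (ρ g).hom)
    (_hproj' : Motives.IsProjectiveOver (Over.mk (π ≫ p)))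
    (hNB2 : ∀ (A : Type) [CommRing A] [IsRegularLocalRing A] (m : ℕ) (t : Fin m → A),
      Ideal.span (Set.range t) = IsLocalRing.maximalIdeal A → ringKrullDim A = m →
      ∀ (s r : ℕ), 2 ≤ s → s ≤ r → r ≤ m → ∀ (a₀ b₀ : Fin m), a₀ < b₀ → b₀.val < s →
      ∀ (B : Scheme.{0}) (ρ₁ : B ⟶ Spec (.of (DeJong1996.NodeDeformationRing A
          (∏ i ∈ Finset.univ.filter (fun i : Fin m => i.val < s), t i)))),
        IsBlowup ρ₁ (Scheme.IdealSheafData.ofIdealTop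
          ((((Ideal.span {t a₀, t b₀}).map (DeJong1996.NodeDeformationRing.ofBase A _) ⊔
              Ideal.span {Ideal.Quotient.mk _ (MvPowerSeries.X 0),
                Ideal.Quotient.mk _ (MvPowerSeries.X 1)})).map
            (Scheme.ΓSpecIso (.of (DeJong1996.NodeDeformationRing A
              (∏ i ∈ Finset.univ.filter (fun i : Fin m => i.val < s), t i)))).inv.hom)) →
        ∀ y : B, IsClosed ({y} : Set B) → (∀ f, f ∈ (ρ₁.base y).asIdeal ∨ IsUnit f) →
          ∃ G w : B.presheaf.stalk y,
            stalkIdeal ((Scheme.IdealSheafData.ofIdealTop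
              ((((Ideal.span {t a₀, t b₀}).map (DeJong1996.NodeDeformationRing.ofBase A _) ⊔
                Ideal.span {Ideal.Quotient.mk _ (MvPowerSeries.X 0),
                  Ideal.Quotient.mk _ (MvPowerSeries.X 1)})).map
              (Scheme.ΓSpecIso (.of (DeJong1996.NodeDeformationRing A
                (∏ i ∈ Finset.univ.filter (fun i : Fin m => i.val < s), t i)))).inv.hom)).comap ρ₁) y =
              Ideal.span {G} ∧
            G ∈ nonZeroDivisors (B.presheaf.stalk y) ∧
            stalkIdeal ((Scheme.IdealSheafData.ofIdealTop
              ((Ideal.span {DeJong1996.NodeDeformationRing.ofBase A _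
                (∏ i ∈ Finset.univ.filter (fun i : Fin m => i.val < r), t i)}).map
              (Scheme.ΓSpecIso (.of (DeJong1996.NodeDeformationRing A
                (∏ i ∈ Finset.univ.filter (fun i : Fin m => i.val < s), t i)))).inv.hom)).comap ρ₁) y =
              Ideal.span {G ^ 2 * w} ∧
            ((stalkIdeal ((Scheme.IdealSheafData.ofIdealTop
              ((Ideal.span {DeJong1996.NodeDeformationRing.ofBase A _
                (∏ i ∈ Finset.univ.filter (fun i : Fin m => i.val < r), t i)}).map
              (Scheme.ΓSpecIso (.of (DeJong1996.NodeDeformationRing A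
                (∏ i ∈ Finset.univ.filter (fun i : Fin m => i.val < s), t i)))).inv.hom)).comap ρ₁) y).map
                (algebraMap (B.presheaf.stalk y) (AdicCompletion
                  (IsLocalRing.maximalIdeal (B.presheaf.stalk y)) (B.presheaf.stalk y)))).radical =
              (Ideal.span {G * w}).map (algebraMap (B.presheaf.stalk y) (AdicCompletion
                  (IsLocalRing.maximalIdeal (B.presheaf.stalk y)) (B.presheaf.stalk y))) ∧
            (IsRegularLocalRing (B.presheaf.stalk y) → IsSNCIdeal (Ideal.span {G * w})) ∧
            (¬ IsRegularLocalRing (B.presheaf.stalk y) →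
              ∃ (A' : Type) (_ : CommRing A') (_ : IsRegularLocalRing A') (t' : Fin m → A') (s' r' : ℕ),
                Ideal.span (Set.range t') = IsLocalRing.maximalIdeal A' ∧ ringKrullDim A' = m ∧
                2 ≤ s' ∧ s' ≤ r' ∧ r' ≤ m ∧
                ∃ e : AdicCompletion (IsLocalRing.maximalIdeal (B.presheaf.stalk y))
                    (B.presheaf.stalk y) ≃+*
                    DeJong1996.NodeDeformationRing A'
                      (∏ i ∈ Finset.univ.filter (fun i : Fin m => i.val < s'), t' i),
                  ((Ideal.span {G * w}).map (algebraMap (B.presheaf.stalk y) _)).map e.toRingHom =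
                    Ideal.span {DeJong1996.NodeDeformationRing.ofBase A' _
                      (∏ i ∈ Finset.univ.filter (fun i : Fin m => i.val < r'), t' i)})) :
    (∀ x' : X', IsClosed ({x'} : Set X') → ∀ [IsRegularLocalRing (X'.presheaf.stalk x')],
      x' ∈ π.base ⁻¹' Z → π.base x' ∈ closure (⋃ g : G, (ρ g).hom.base '' (Subtype.val '' E)) →
        ∀ (U : X'.affineOpens) (hU : x' ∈ (U : X'.Opens)),
          IsSNCIdeal (completedStalkIdeal (Scheme.IdealSheafData.vanishingIdeal
            ⟨π.base ⁻¹' Z, hP.isClosed.preimage π.continuous⟩) x' U hU)) ∧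
    (∀ x' : X', IsClosed ({x'} : Set X') → ¬ IsRegularLocalRing (X'.presheaf.stalk x') →
      π.base x' ∈ closure (⋃ g : G, (ρ g).hom.base '' (Subtype.val '' E)) →
        ∃ (A : Type) (_ : CommRing A) (_ : IsRegularLocalRing A) (t : Fin (d - 1) → A) (s r : ℕ),
          Ideal.span (Set.range t) = IsLocalRing.maximalIdeal A ∧ ringKrullDim A = (d - 1 : ℕ) ∧
          2 ≤ s ∧ s ≤ r ∧ r ≤ d - 1 ∧
          ∃ e : AdicCompletion (IsLocalRing.maximalIdeal (X'.presheaf.stalk x'))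
              (X'.presheaf.stalk x') ≃+*
              DeJong1996.NodeDeformationRing A
                (∏ i ∈ Finset.univ.filter (fun i : Fin (d - 1) => i.val < s), t i),
            ∀ (U : X'.affineOpens) (hU : x' ∈ (U : X'.Opens)),
              (completedStalkIdeal (Scheme.IdealSheafData.vanishingIdeal
                  ⟨π.base ⁻¹' Z, hP.isClosed.preimage π.continuous⟩) x' U hU).map e.toRingHom =
                Ideal.span {DeJong1996.NodeDeformationRing.ofBase A _
                  (∏ i ∈ Finset.univ.filter (fun i : Fin (d - 1) => i.val < r), t i)}) := by
  haveI := hP.isIntegral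
  haveI := hP.locallyOfFiniteType
  haveI : IsNoetherian X := hP.isNoetherian
  haveI : IsProper π := hπ.isProper
  exact ⟨fun x' hx'c _ _ hx => (chartsOverCentre_point_of_model hP hE hπ hNB2 hx'c hx).1,
    fun x' hx'c hsing hx => (chartsOverCentre_point_of_model hP hE hπ hNB2 hx'c hx).2 hsing⟩

end Summit.ResolutionOfSingularities.ResolutionOfSingularities.Theorems

end
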